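import Mathlib
import Summits.MatrixMultiplication.MatrixMultiplication.Theorems.ThinBlockAlphaThinPackingsOrbitCriterion

set_option linter.dupNamespace false

/-!
# Orbit designs for `ThinPackings`: packing necessities (stub `stub_orbitPacking`)

Line `automorphism-orbit-twisted-templates` (skeleton `Ideator4Sketch`) of crux
`ThinBlockAlpha.ThinPackings` (stmt-MatrixMultiplication-10595).

For an orbit design — a finite group `Γ` acting on a finite abelian `H` by additive automorphisms and
a template `(A, B, C)` that is TPP (`TemplateTPP`) and `Γ`-twisted sum-free (`TwistedSumFree`) — the
three difference sets `A − C`, `A − B`, `B − C` are moved off themselves by every `g ≠ 1`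
(specialise the twisted clause to the label pairs `(g, g)`, `(g, 1)`, `(1, g)`), and consequently
`|Γ| · |A| · |C| ≤ |H|` (and the two analogues): the map `(g, a, c) ↦ g • (a − c)` is injective on
`Γ × A × C` (TPP on a fixed `g`, the disjointness across two different `g`'s).
-/

namespace Summit.MatrixMultiplication.MatrixMultiplication.Theorems.ThinPackings.Orbit

open Finset
open scoped Pointwise

section Disjoint

variable {Γ H : Type} [Group Γ] [AddCommGroup H] [DecidableEq H] [DistribMulAction Γ H]

/-- Twisted sum-freeness at labels `(g, g)`, `g ≠ 1`: `g • (A − C)` misses `A − C`. -/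
theorem disjoint_image_smul_sub_AC (A B C : Finset H) (hB : B.Nonempty)
    (hTw : TwistedSumFree Γ A B C) (g : Γ) (hg : g ≠ 1) :
    Disjoint ((A - C).image fun x => g • x) (A - C) := by
  obtain ⟨b, hb⟩ := hB
  rw [Finset.disjoint_left]
  intro x hx hx'
  rw [Finset.mem_image] at hx
  obtain ⟨y, hy, rfl⟩ := hx
  rw [Finset.mem_sub] at hy hx'
  obtain ⟨a', ha', c, hc, rfl⟩ := hy
  obtain ⟨a, ha, c', hc', h⟩ := hx'
  have hgg : ((g, g) : Γ × Γ) ≠ (1, 1) := fun h1 => hg (congrArg Prod.fst h1)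
  refine hTw g g hgg a' ha' b hb b hb c hc c' hc' a ha ?_
  rw [← smul_add, sub_add_sub_cancel, ← h, sub_add_sub_cancel, sub_self]

/-- Twisted sum-freeness at labels `(g, 1)`, `g ≠ 1`: `g • (A − B)` misses `A − B`. -/
theorem disjoint_image_smul_sub_AB (A B C : Finset H) (hC : C.Nonempty)
    (hTw : TwistedSumFree Γ A B C) (g : Γ) (hg : g ≠ 1) :
    Disjoint ((A - B).image fun x => g • x) (A - B) := by
  obtain ⟨c, hc⟩ := hC
  rw [Finset.disjoint_left]
  intro x hx hx'
  rw [Finset.mem_image] at hx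
  obtain ⟨y, hy, rfl⟩ := hx
  rw [Finset.mem_sub] at hy hx'
  obtain ⟨a', ha', b, hb, rfl⟩ := hy
  obtain ⟨a, ha, b', hb', h⟩ := hx'
  have hg1 : ((g, (1 : Γ)) : Γ × Γ) ≠ (1, 1) := fun h1 => hg (congrArg Prod.fst h1)
  refine hTw g 1 hg1 a' ha' b hb b' hb' c hc c hc a ha ?_
  rw [one_smul, ← h, sub_add_sub_cancel, sub_add_sub_cancel, sub_self]

/-- Twisted sum-freeness at labels `(1, g)`, `g ≠ 1`: `g • (B − C)` misses `B − C`. -/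
theorem disjoint_image_smul_sub_BC (A B C : Finset H) (hA : A.Nonempty)
    (hTw : TwistedSumFree Γ A B C) (g : Γ) (hg : g ≠ 1) :
    Disjoint ((B - C).image fun x => g • x) (B - C) := by
  obtain ⟨a, ha⟩ := hA
  rw [Finset.disjoint_left]
  intro x hx hx'
  rw [Finset.mem_image] at hx
  obtain ⟨y, hy, rfl⟩ := hx
  rw [Finset.mem_sub] at hy hx'
  obtain ⟨b', hb', c, hc, rfl⟩ := hy
  obtain ⟨b, hb, c', hc', h⟩ := hx'
  have h1g : (((1 : Γ), g) : Γ × Γ) ≠ (1, 1) := fun h1 => hg (congrArg Prod.snd h1)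
  refine hTw 1 g h1g a ha b hb b' hb' c hc c' hc' a ha ?_
  rw [one_smul, ← h, sub_add_sub_cancel, sub_add_sub_cancel, sub_self]

end Disjoint

section Inj

variable {H : Type} [AddCommGroup H]

/-- TPP makes `(a, c) ↦ a − c` injective on `A × C` (given some `b ∈ B`). -/
theorem sub_inj_AC_of_templateTPP (A B C : Finset H) (hB : B.Nonempty) (hT : TemplateTPP A B C) :
    ∀ a ∈ A, ∀ c ∈ C, ∀ a' ∈ A, ∀ c' ∈ C, a - c = a' - c' → a = a' ∧ c = c' := by
  obtain ⟨b, hb⟩ := hB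
  intro a ha c hc a' ha' c' hc' h
  have key : (a' - a) + (b - b) + (c - c') = (a' - c') - (a - c) := by abel
  have := hT a ha a' ha' b hb b hb c' hc' c hc (by rw [key, h, sub_self])
  exact ⟨this.1, this.2.2.symm⟩

/-- TPP makes `(a, b) ↦ a − b` injective on `A × B` (given some `c ∈ C`). -/
theorem sub_inj_AB_of_templateTPP (A B C : Finset H) (hC : C.Nonempty) (hT : TemplateTPP A B C) :
    ∀ a ∈ A, ∀ b ∈ B, ∀ a' ∈ A, ∀ b' ∈ B, a - b = a' - b' → a = a' ∧ b = b' := by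
  obtain ⟨c, hc⟩ := hC
  intro a ha b hb a' ha' b' hb' h
  have key : (a' - a) + (b - b') + (c - c) = (a' - b') - (a - b) := by abel
  have := hT a ha a' ha' b' hb' b hb c hc c hc (by rw [key, h, sub_self])
  exact ⟨this.1, this.2.1.symm⟩

/-- TPP makes `(b, c) ↦ b − c` injective on `B × C` (given some `a ∈ A`). -/
theorem sub_inj_BC_of_templateTPP (A B C : Finset H) (hA : A.Nonempty) (hT : TemplateTPP A B C) :
    ∀ b ∈ B, ∀ c ∈ C, ∀ b' ∈ B, ∀ c' ∈ C, b - c = b' - c' → b = b' ∧ c = c' := by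
  obtain ⟨a, ha⟩ := hA
  intro b hb c hc b' hb' c' hc' h
  have key : (a - a) + (b' - b) + (c - c') = (b' - c') - (b - c) := by abel
  have := hT a ha a ha b hb b' hb' c' hc' c hc (by rw [key, h, sub_self])
  exact ⟨this.2.1, this.2.2.symm⟩

end Inj

section Count

variable {Γ H : Type} [Group Γ] [Fintype Γ] [AddCommGroup H] [Fintype H] [DecidableEq H]
  [DistribMulAction Γ H]

/-- **Packing count.**  If every `g ≠ 1` moves `S − T` off itself and subtraction is injective on
`S × T`, then `(g, s, t) ↦ g • (s − t)` is injective on `Γ × S × T`, so `|Γ|·|S|·|T| ≤ |H|`. -/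
theorem card_mul_card_mul_card_le (S T : Finset H)
    (hdisj : ∀ g : Γ, g ≠ 1 → Disjoint ((S - T).image fun x => g • x) (S - T))
    (hinj : ∀ s ∈ S, ∀ t ∈ T, ∀ s' ∈ S, ∀ t' ∈ T, s - t = s' - t' → s = s' ∧ t = t') :
    Fintype.card Γ * (S.card * T.card) ≤ Fintype.card H := by
  classical
  have hcard : ((univ : Finset Γ) ×ˢ (S ×ˢ T)).card = Fintype.card Γ * (S.card * T.card) := by
    rw [card_product, card_product, card_univ]
  rw [← hcard, ← Finset.card_univ (α := H)]
  refine card_le_card_of_injOn (fun p => p.1 • (p.2.1 - p.2.2))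
    (fun _ _ => mem_coe.2 (mem_univ _)) ?_
  rintro ⟨g, s, t⟩ hp ⟨g', s', t'⟩ hq hpq
  simp only [mem_coe, mem_product, mem_univ, true_and] at hp hq
  simp only at hpq
  by_cases hg : g = g'
  · subst hg
    obtain ⟨rfl, rfl⟩ := hinj s hp.1 t hp.2 s' hq.1 t' hq.2 (MulAction.injective g hpq)
    rfl
  · exfalso
    have hne : g'⁻¹ * g ≠ 1 := fun h => hg (inv_mul_eq_one.1 h).symm
    have hmem : (g'⁻¹ * g) • (s - t) ∈ (S - T).image fun x => (g'⁻¹ * g) • x :=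
      mem_image_of_mem _ (Finset.sub_mem_sub hp.1 hp.2)
    have hmem' : (g'⁻¹ * g) • (s - t) ∈ S - T := by
      rw [mul_smul, hpq, inv_smul_smul]
      exact Finset.sub_mem_sub hq.1 hq.2
    exact Finset.disjoint_left.1 (hdisj _ hne) hmem hmem'

end Count

/-- **Registered stub `stub_orbitPacking`** of the line's skeleton (crux
stmt-MatrixMultiplication-10595), verbatim: the packing necessities of an orbit design — every
`g ≠ 1` moves each of `A − C`, `A − B`, `B − C` off itself, hence `|Γ|·|A||C|`, `|Γ|·|A||B|`,
`|Γ|·|B||C|` are all at most `|H|`. [new, elementary] -/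
theorem stub_orbitPacking : ∀ {Γ H : Type} [Group Γ] [Fintype Γ] [AddCommGroup H] [Fintype H] [DecidableEq H] [DistribMulAction Γ H] (A B C : Finset H), A.Nonempty → B.Nonempty → C.Nonempty → TemplateTPP A B C → TwistedSumFree Γ A B C → (∀ g : Γ, g ≠ 1 → Disjoint ((A - C).image fun x => g • x) (A - C)) ∧ (∀ g : Γ, g ≠ 1 → Disjoint ((A - B).image fun x => g • x) (A - B)) ∧ (∀ g : Γ, g ≠ 1 → Disjoint ((B - C).image fun x => g • x) (B - C)) ∧ Fintype.card Γ * (A.card * C.card) ≤ Fintype.card H ∧ Fintype.card Γ * (A.card * B.card) ≤ Fintype.card H ∧ Fintype.card Γ * (B.card * C.card) ≤ Fintype.card H := by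
  intro Γ H _ _ _ _ _ _ A B C hA hB hC hT hTw
  have hAC := disjoint_image_smul_sub_AC A B C hB hTw
  have hAB := disjoint_image_smul_sub_AB A B C hC hTw
  have hBC := disjoint_image_smul_sub_BC A B C hA hTw
  exact ⟨hAC, hAB, hBC,
    card_mul_card_mul_card_le A C hAC (sub_inj_AC_of_templateTPP A B C hB hT),
    card_mul_card_mul_card_le A B hAB (sub_inj_AB_of_templateTPP A B C hC hT),
    card_mul_card_mul_card_le B C hBC (sub_inj_BC_of_templateTPP A B C hA hT)⟩

end Summit.MatrixMultiplication.MatrixMultiplication.Theorems.ThinPackings.Orbit
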